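import Literature.NumberTheory.Automorphic.DerivWeightDilation
import Literature.NumberTheory.Automorphic.MixedSpaceMomentKernels
import Literature.NumberTheory.Automorphic.TestFunctionDerivLinear
import HarnessLib

/-!
# The word expansion of the Kirillov `L²`-bound for `GL_2`: derivatives of `g ⋆ L_{a(y)} θ`

Topic `NumberTheory/Automorphic`; namespace `Literature.NumberTheory.Automorphic`. Definitions with
bodies and theorems (no named fact). For a test function `θ` on `GL_2(𝔸_K)`, a moment kernel `g` on
`K_∞` (`IsMomentKernelGE`) and the archimedean torus `a(y)`, `y ∈ K_∞ˣ`, consider the family of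
weights `y ↦ g ⋆ L_{a(y)} θ` (`dilAtom`: smoothing along the archimedean unipotent line of the left
translate of `θ`). The archimedean Sobolev words of the Whittaker functional bound
(`norm_whittakerCoeff_sum_invQuot_smoothedForm_le`) act on such weights, and we PROVE the structure
theorem of the commutation calculus (Jacquet–Shalika (1981), §4; the `GL_2(ℝ)` Kirillov model,
Bump (1997), §2.8):

* `IsDilRepresentable M N Φ` — the family `Φ : (weights) → K_∞ˣ → (weights)` is a finite sum
  `Φ θ y = ∑_j c_j(y) · (g_j ⋆ L_{a(y)} θ_{u_j})`, uniformly in the test function `θ` (the data do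
  not depend on `θ`), with coefficients dominated by torus monomials
  `|c_j(y)| ≤ C_j ∏_w |y_w|_w^{m_{j,w}}`, `m_{j,w} ≤ N` (`IsTorusCoeff`), kernels `g_j` moment kernels
  of order `≥ M` and `θ_{u_j} = wordDerivWeight u_j θ` archimedean derivatives of `θ`;
* closure under sums, torus-monomial coefficients (`IsDilRepresentable.add/sum/coeff_smul`);
* `IsDilRepresentable.derivWeight` — **one letter**: if `Φ` is `(M+2, N)`-representable then
  `(θ, y) ↦ (Φ θ y)_X` is `(M, N+1)`-representable. Mechanism, for an atom `g ⋆ L_{a(y)} θ'`: commute `X`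
  past the convolution (`derivWeight_archUnipotentConv_expand`: kernels `g, x_b g, x_b x_{b'} g`),
  split each letter `Z = Z₀₁E + D + Z₁₀F` (`derivWeight_split_letters`); the `E`-part is absorbed by
  the kernel (`archUnipotentConv_derivWeight_smul_matE`: kernel `-∂_{Z₀₁} g`, no cost), the diagonal
  part passes through `L_{a(y)}` unchanged, the `F`-part passes through at the cost of ONE power of
  `y` (`derivWeight_leftTranslate_archDilation_lowerDir_expand`);
* `isDilRepresentable_wordDerivWeight_dilAtom` — **words**: for `g` of order `≥ M + 2|w|`,
  `(θ, y) ↦ (g ⋆ L_{a(y)} θ)_w` is `(M, |w|)`-representable, with data independent of `θ`.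

In words: along the archimedean torus the Sobolev norms of the smoothed translates
`R(a(y)) S_θ f` grow at most polynomially in `|y|`, with the polynomial weight carried by FIXED
vectors `S_{θ_u} f` smoothed along the unipotent line — the input of the dilation integral
(`KirillovDilationGL2`).

## References

* H. Jacquet, J. A. Shalika, *On Euler products and the classification of automorphic
  representations I*, Amer. J. Math. 103 (1981), §4 [JacquetShalikaAJM1981].
* D. Bump, *Automorphic Forms and Representations* (1997), §2.2 (2.28)–(2.29), §2.8 [Bump1997].
-/

noncomputable section

open scoped MatrixGroups Classical ContDiff
open NumberField NumberField.mixedEmbedding NumberField.InfinitePlace IsDedekindDomain MeasureTheory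

namespace Literature.NumberTheory.Automorphic

variable {K : Type} [Field K] [NumberField K]
  (hcpt : isCompact_glFiniteIntegralLevel 2 K)

set_option backward.isDefEq.respectTransparency false
set_option synthInstance.maxHeartbeats 400000

attribute [local instance 100] LieRing.ofAssociativeRing

open scoped Matrix.Norms.Operator

/-! ### Torus monomials and dominated coefficients -/

/-- The torus monomial `y ↦ ∏_w |y_w|_w^{m_w}` on `K_∞ˣ` (`|·|_w = normAtPlace w`). [folklore] -/
def torusMonomial (m : InfinitePlace K → ℕ) (y : (mixedSpace K)ˣ) : ℝ :=
  ∏ w, normAtPlace w (y : mixedSpace K) ^ m w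

/-- Torus monomials are non-negative. [folklore] -/
theorem torusMonomial_nonneg (m : InfinitePlace K → ℕ) (y : (mixedSpace K)ˣ) : 0 ≤ torusMonomial m y :=
  Finset.prod_nonneg fun w _ => pow_nonneg (normAtPlace_nonneg w _) _

/-- `∏_w |y_w|^0 = 1`. [folklore] -/
@[simp]
theorem torusMonomial_zero (y : (mixedSpace K)ˣ) : torusMonomial 0 y = 1 := by
  simp [torusMonomial]

/-- Torus monomials multiply by adding exponents. [folklore] -/
theorem torusMonomial_add (m m' : InfinitePlace K → ℕ) (y : (mixedSpace K)ˣ) :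
    torusMonomial (m + m') y = torusMonomial m y * torusMonomial m' y := by
  simp only [torusMonomial, Pi.add_apply, pow_add, Finset.prod_mul_distrib]

/-- The monomial of `Pi.single w 1` is `|y_w|_w`. [folklore] -/
theorem torusMonomial_single (w : InfinitePlace K) (y : (mixedSpace K)ˣ) :
    torusMonomial (Pi.single w 1) y = normAtPlace w (y : mixedSpace K) := by
  rw [torusMonomial, Finset.prod_eq_single w]
  · simp
  · intro w' _ hw'
    simp [Pi.single_eq_of_ne hw']
  · simp

/-- A real function on `K_∞ˣ` dominated by the torus monomial of exponent `m`. [folklore] -/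
def IsTorusCoeff (m : InfinitePlace K → ℕ) (c : (mixedSpace K)ˣ → ℝ) : Prop :=
  ∃ C : ℝ, ∀ y, |c y| ≤ C * torusMonomial m y

/-- Constants are dominated with exponent `0`. [folklore] -/
theorem isTorusCoeff_const (a : ℝ) : IsTorusCoeff (K := K) 0 fun _ => a :=
  ⟨|a|, fun y => by simp⟩

/-- Products of dominated coefficients are dominated, exponents adding. [folklore] -/
theorem IsTorusCoeff.mul {m m' : InfinitePlace K → ℕ} {c c' : (mixedSpace K)ˣ → ℝ} (hc : IsTorusCoeff m c)
    (hc' : IsTorusCoeff m' c') : IsTorusCoeff (m + m') fun y => c y * c' y := by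
  obtain ⟨C, hC⟩ := hc
  obtain ⟨C', hC'⟩ := hc'
  refine ⟨C * C', fun y => ?_⟩
  rw [abs_mul, torusMonomial_add]
  calc |c y| * |c' y| ≤ (C * torusMonomial m y) * (C' * torusMonomial m' y) :=
        mul_le_mul (hC y) (hC' y) (abs_nonneg _) ((abs_nonneg _).trans (hC y))
    _ = C * C' * (torusMonomial m y * torusMonomial m' y) := by ring

/-- **The coefficient `y ↦ (y z)_b` is dominated by `|y|_{w(b)}`.** [folklore] -/
theorem isTorusCoeff_repr_mul (b : index K) (z : mixedSpace K) :
    IsTorusCoeff (Pi.single (indexPlace K b) 1) fun y : (mixedSpace K)ˣ => (stdBasis K).repr ((y : mixedSpace K) * z) b := by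
  refine ⟨normAtPlace (indexPlace K b) z, fun y => ?_⟩
  rw [torusMonomial_single]
  calc |(stdBasis K).repr ((y : mixedSpace K) * z) b| ≤ normAtPlace (indexPlace K b) ((y : mixedSpace K) * z) :=
        abs_repr_le_normAtPlace K _ b
    _ = normAtPlace (indexPlace K b) z * normAtPlace (indexPlace K b) (y : mixedSpace K) := by rw [map_mul, mul_comm]

/-! ### Linearity of the convolution in the weight -/

/-- The convolution integrand `x ↦ g₀(x) η(n(x)⁻¹ h)` is integrable for `g₀` continuous compactly
supported and `η` continuous. [folklore] -/
theorem integrable_archUnipotentConv_integrand {g₀ : mixedSpace K → ℝ} (hg₀ : Continuous g₀) (hg₀s : HasCompactSupport g₀)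
    {η : (AdelicGroupData.gl 2 K).Adelic → ℝ} (hη : Continuous η) (h : (AdelicGroupData.gl 2 K).Adelic) :
    Integrable fun x => g₀ x * η ((archUnipotentAdelic K x)⁻¹ * h) :=
  ((continuous_archUnipotentConv_kernel hg₀ hη).comp (continuous_id.prodMk continuous_const)).integrable_of_hasCompactSupport
    hg₀s.mul_right

/-- The convolution is additive in the weight. [folklore] -/
theorem archUnipotentConv_add_weight {g₀ : mixedSpace K → ℝ} (hg₀ : Continuous g₀) (hg₀s : HasCompactSupport g₀)
    {η η' : (AdelicGroupData.gl 2 K).Adelic → ℝ} (hη : Continuous η) (hη' : Continuous η') :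
    archUnipotentConv g₀ (η + η') = archUnipotentConv g₀ η + archUnipotentConv g₀ η' := by
  funext h
  simp only [archUnipotentConv, Pi.add_apply, mul_add]
  exact integral_add (integrable_archUnipotentConv_integrand hg₀ hg₀s hη h)
    (integrable_archUnipotentConv_integrand hg₀ hg₀s hη' h)

/-- The convolution is homogeneous in the weight. [folklore] -/
theorem archUnipotentConv_smul_weight (g₀ : mixedSpace K → ℝ) (a : ℝ) (η : (AdelicGroupData.gl 2 K).Adelic → ℝ) :
    archUnipotentConv g₀ (a • η) = a • archUnipotentConv g₀ η := by
  funext h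
  simp only [archUnipotentConv, Pi.smul_apply, smul_eq_mul, ← integral_const_mul]
  congr 1
  funext x
  ring

/-- The convolution commutes with finite sums of continuous weights. [folklore] -/
theorem archUnipotentConv_sum_weight {g₀ : mixedSpace K → ℝ} (hg₀ : Continuous g₀) (hg₀s : HasCompactSupport g₀)
    {ι' : Type*} (s : Finset ι') {η : ι' → (AdelicGroupData.gl 2 K).Adelic → ℝ} (hη : ∀ i ∈ s, Continuous (η i)) :
    archUnipotentConv g₀ (∑ i ∈ s, η i) = ∑ i ∈ s, archUnipotentConv g₀ (η i) := by
  induction s using Finset.induction_on with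
  | empty =>
    funext h
    simp [archUnipotentConv]
  | insert i s hi ih =>
    have hc : Continuous (∑ j ∈ s, η j) := by
      rw [Finset.sum_fn]
      exact continuous_finsetSum s fun j hj => hη j (Finset.mem_insert_of_mem hj)
    rw [Finset.sum_insert hi, Finset.sum_insert hi,
      archUnipotentConv_add_weight hg₀ hg₀s (hη i (Finset.mem_insert_self i s)) hc,
      ih fun j hj => hη j (Finset.mem_insert_of_mem hj)]

/-- The convolution is odd in the kernel: `(-g₀) ⋆ η = -(g₀ ⋆ η)`. [folklore] -/
theorem archUnipotentConv_neg_kernel (g₀ : mixedSpace K → ℝ) (η : (AdelicGroupData.gl 2 K).Adelic → ℝ) :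
    archUnipotentConv (fun x => -g₀ x) η = -archUnipotentConv g₀ η := by
  funext h
  simp only [archUnipotentConv, Pi.neg_apply, neg_mul, integral_neg]

/-! ### Atoms and representable families -/

/-- **The atom** `y ↦ g ⋆ L_{a(y)} θ`: the unipotent smoothing by the kernel `g` of the left translate
of the weight `θ` by the archimedean torus element `a(y)`. [cite: JacquetShalikaAJM1981, §4] -/
def dilAtom (g : mixedSpace K → ℝ) (θ : GL (Fin 2) (AdeleRing (𝓞 K) K) → ℝ) (y : (mixedSpace K)ˣ) :
    GL (Fin 2) (AdeleRing (𝓞 K) K) → ℝ :=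
  archUnipotentConv g (leftTranslateWeight (n := 2) (archDilationGL K y) θ)

/-- Atoms of test functions by smooth compactly supported kernels are test functions. [folklore] -/
theorem isTestFunctionGL_dilAtom {g : mixedSpace K → ℝ} (hg : ContDiff ℝ ∞ g) (hgs : HasCompactSupport g)
    {θ : GL (Fin 2) (AdeleRing (𝓞 K) K) → ℝ} (hθ : IsTestFunctionGL 2 K θ) (y : (mixedSpace K)ˣ) :
    IsTestFunctionGL 2 K (dilAtom g θ y) :=
  isTestFunctionGL_archUnipotentConv (hθ.leftTranslate _) hg hgs

/-- A term of a representable family: coefficient, its exponent, kernel, word. [folklore] -/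
structure DilTerm (K : Type) [Field K] [NumberField K] (hcpt : isCompact_glFiniteIntegralLevel 2 K) where
  /-- the coefficient `y ↦ c(y)` -/
  coeff : (mixedSpace K)ˣ → ℝ
  /-- the exponent of the dominating torus monomial -/
  expo : InfinitePlace K → ℕ
  /-- the unipotent smoothing kernel on `K_∞` -/
  kernel : mixedSpace K → ℝ
  /-- the archimedean word differentiating the weight -/
  word : List (AutomorphyDatum.gl 2 K hcpt).arch.lie

/-- Admissibility of a term at orders `(M, N)`: dominated coefficient with exponents `≤ N`, moment
kernel of order `≥ M`. [folklore] -/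
def DilTerm.Admissible (M N : ℕ) (T : DilTerm K hcpt) : Prop :=
  IsTorusCoeff T.expo T.coeff ∧ (∀ w, T.expo w ≤ N) ∧ IsMomentKernelGE K M T.kernel

/-- The weight family of a term: `y ↦ c(y) · (g ⋆ L_{a(y)} θ_u)`. [folklore] -/
def DilTerm.eval (T : DilTerm K hcpt) (θ : GL (Fin 2) (AdeleRing (𝓞 K) K) → ℝ) (y : (mixedSpace K)ˣ) :
    GL (Fin 2) (AdeleRing (𝓞 K) K) → ℝ :=
  T.coeff y • dilAtom T.kernel (wordDerivWeight (AutomorphyDatum.gl 2 K hcpt).ofArch T.word θ) y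

/-- **Representable families, uniformly in the weight**: `Φ θ y = ∑_j c_j(y) · (g_j ⋆ L_{a(y)} θ_{u_j})`
over a finite index set with `(M, N)`-admissible terms, for EVERY test function `θ` (the data
`c_j, g_j, u_j` do not depend on `θ`). [cite: JacquetShalikaAJM1981, §4] -/
def IsDilRepresentable (M N : ℕ)
    (Φ : (GL (Fin 2) (AdeleRing (𝓞 K) K) → ℝ) → (mixedSpace K)ˣ → GL (Fin 2) (AdeleRing (𝓞 K) K) → ℝ) : Prop :=
  ∃ (ι' : Type) (_ : Fintype ι') (T : ι' → DilTerm K hcpt),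
    (∀ i, (T i).Admissible hcpt M N) ∧
      ∀ θ : GL (Fin 2) (AdeleRing (𝓞 K) K) → ℝ, IsTestFunctionGL 2 K θ → ∀ y, Φ θ y = ∑ i, (T i).eval hcpt θ y

namespace IsDilRepresentable

variable {hcpt}
variable {M N : ℕ}

/-- Families agreeing on test functions are simultaneously representable. [folklore] -/
theorem congr {Φ Φ' : (GL (Fin 2) (AdeleRing (𝓞 K) K) → ℝ) → (mixedSpace K)ˣ → GL (Fin 2) (AdeleRing (𝓞 K) K) → ℝ}
    (hΦ : IsDilRepresentable hcpt M N Φ)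
    (h : ∀ θ, IsTestFunctionGL 2 K θ → ∀ y, Φ θ y = Φ' θ y) : IsDilRepresentable hcpt M N Φ' := by
  obtain ⟨ι', _, T, hT, hΦT⟩ := hΦ
  exact ⟨ι', inferInstance, T, hT, fun θ hθ y => (h θ hθ y).symm.trans (hΦT θ hθ y)⟩

/-- Weakening of the orders. [folklore] -/
theorem mono {Φ : (GL (Fin 2) (AdeleRing (𝓞 K) K) → ℝ) → (mixedSpace K)ˣ → GL (Fin 2) (AdeleRing (𝓞 K) K) → ℝ}
    {M' N' : ℕ} (hΦ : IsDilRepresentable hcpt M N Φ) (hM : M' ≤ M) (hN : N ≤ N') : IsDilRepresentable hcpt M' N' Φ := by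
  obtain ⟨ι', _, T, hT, hΦT⟩ := hΦ
  exact ⟨ι', inferInstance, T, fun i => ⟨(hT i).1, fun w => ((hT i).2.1 w).trans hN, (hT i).2.2.mono hM⟩, hΦT⟩

/-- The zero family. [folklore] -/
theorem zero : IsDilRepresentable hcpt M N fun _ _ => 0 := by
  refine ⟨PEmpty, inferInstance, (fun i => nomatch i), ?_, ?_⟩
  · intro i; exact nomatch i
  · intro θ _ y; simp

/-- **Atoms are representable**: `(θ, y) ↦ g ⋆ L_{a(y)} θ_u` for a moment kernel `g` of order `≥ M`. [folklore] -/
theorem atom {g : mixedSpace K → ℝ} (hg : IsMomentKernelGE K M g) (u : List (AutomorphyDatum.gl 2 K hcpt).arch.lie) :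
    IsDilRepresentable hcpt M N fun θ y => dilAtom g (wordDerivWeight (AutomorphyDatum.gl 2 K hcpt).ofArch u θ) y := by
  refine ⟨PUnit, inferInstance, fun _ => ⟨fun _ => 1, 0, g, u⟩, fun _ => ⟨?_, fun _ => Nat.zero_le _, hg⟩, fun θ _ y => ?_⟩
  · exact isTorusCoeff_const 1
  · simp [DilTerm.eval]

/-- Sums of representable families. [folklore] -/
theorem add {Φ Φ' : (GL (Fin 2) (AdeleRing (𝓞 K) K) → ℝ) → (mixedSpace K)ˣ → GL (Fin 2) (AdeleRing (𝓞 K) K) → ℝ}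
    (hΦ : IsDilRepresentable hcpt M N Φ) (hΦ' : IsDilRepresentable hcpt M N Φ') :
    IsDilRepresentable hcpt M N fun θ y => Φ θ y + Φ' θ y := by
  obtain ⟨ι₁, _, T₁, hT₁, hΦT₁⟩ := hΦ
  obtain ⟨ι₂, _, T₂, hT₂, hΦT₂⟩ := hΦ'
  refine ⟨ι₁ ⊕ ι₂, inferInstance, Sum.elim T₁ T₂, ?_, fun θ hθ y => ?_⟩
  · rintro (i | i)
    · exact hT₁ i
    · exact hT₂ i
  · show Φ θ y + Φ' θ y = _
    rw [Fintype.sum_sum_type, hΦT₁ θ hθ y, hΦT₂ θ hθ y]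
    rfl

/-- Finite sums of representable families. [folklore] -/
theorem sum {ι' : Type*} (s : Finset ι')
    {Φ : ι' → (GL (Fin 2) (AdeleRing (𝓞 K) K) → ℝ) → (mixedSpace K)ˣ → GL (Fin 2) (AdeleRing (𝓞 K) K) → ℝ}
    (hΦ : ∀ i ∈ s, IsDilRepresentable hcpt M N (Φ i)) : IsDilRepresentable hcpt M N fun θ y => ∑ i ∈ s, Φ i θ y := by
  induction s using Finset.induction_on with
  | empty => simpa using (zero : IsDilRepresentable hcpt M N fun _ _ => 0)
  | insert i s hi ih =>
    have h := (hΦ i (Finset.mem_insert_self i s)).add (ih fun j hj => hΦ j (Finset.mem_insert_of_mem hj))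
    refine h.congr fun θ _ y => ?_
    rw [Finset.sum_insert hi]

/-- **Multiplication by a dominated coefficient** raises the exponent bound. [folklore] -/
theorem coeff_smul {Φ : (GL (Fin 2) (AdeleRing (𝓞 K) K) → ℝ) → (mixedSpace K)ˣ → GL (Fin 2) (AdeleRing (𝓞 K) K) → ℝ}
    (hΦ : IsDilRepresentable hcpt M N Φ) {m : InfinitePlace K → ℕ} {c : (mixedSpace K)ˣ → ℝ} (hc : IsTorusCoeff m c)
    {N' : ℕ} (hm : ∀ w, m w ≤ N') : IsDilRepresentable hcpt M (N + N') fun θ y => c y • Φ θ y := by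
  obtain ⟨ι', _, T, hT, hΦT⟩ := hΦ
  refine ⟨ι', inferInstance, fun i => ⟨fun y => c y * (T i).coeff y, m + (T i).expo, (T i).kernel, (T i).word⟩,
    fun i => ⟨hc.mul (hT i).1, fun w => ?_, (hT i).2.2⟩, fun θ hθ y => ?_⟩
  · show (m + (T i).expo) w ≤ N + N'
    rw [Pi.add_apply, add_comm]
    exact add_le_add ((hT i).2.1 w) (hm w)
  · show c y • Φ θ y = _
    rw [hΦT θ hθ y, Finset.smul_sum]
    refine Finset.sum_congr rfl fun i _ => ?_
    simp only [DilTerm.eval, smul_smul]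

/-- Real scalar multiples. [folklore] -/
theorem smul {Φ : (GL (Fin 2) (AdeleRing (𝓞 K) K) → ℝ) → (mixedSpace K)ˣ → GL (Fin 2) (AdeleRing (𝓞 K) K) → ℝ}
    (hΦ : IsDilRepresentable hcpt M N Φ) (a : ℝ) : IsDilRepresentable hcpt M N fun θ y => a • Φ θ y := by
  simpa using hΦ.coeff_smul (isTorusCoeff_const a) (N' := 0) fun _ => le_rfl

/-- Negation. [folklore] -/
theorem neg {Φ : (GL (Fin 2) (AdeleRing (𝓞 K) K) → ℝ) → (mixedSpace K)ˣ → GL (Fin 2) (AdeleRing (𝓞 K) K) → ℝ}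
    (hΦ : IsDilRepresentable hcpt M N Φ) : IsDilRepresentable hcpt M N fun θ y => -Φ θ y := by
  simpa using hΦ.smul (-1)

end IsDilRepresentable

/-! ### One letter on an atom -/

section OneLetter

variable {hcpt}

/-- **A kernel against a differentiated translate, split by letters**: for a moment kernel `κ` of
order `≥ M`, a word `u` and `Z ∈ 𝔤`, the family `(θ, y) ↦ κ ⋆ (L_{a(y)} θ_u)_Z` is
`(M, 1)`-representable, where `θ_u = wordDerivWeight u θ`:
`κ ⋆ (L_a θ')_Z = (-∂_{Z₀₁} κ) ⋆ L_a θ' + κ ⋆ L_a (θ'_{D(Z)}) + ∑_b (y Z₁₀)_b · κ ⋆ L_a (θ'_{bF})`.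
[cite: JacquetShalikaAJM1981, §4] -/
theorem isDilRepresentable_conv_derivWeight_leftTranslate {M : ℕ}
    {κ : mixedSpace K → ℝ} (hκ : IsMomentKernelGE K M κ) (u : List (AutomorphyDatum.gl 2 K hcpt).arch.lie)
    (Z : (AutomorphyDatum.gl 2 K hcpt).arch.lie) :
    IsDilRepresentable hcpt M 1 fun θ y => archUnipotentConv κ
      (derivWeight (AutomorphyDatum.gl 2 K hcpt).ofArch Z
        (leftTranslateWeight (n := 2) (archDilationGL K y) (wordDerivWeight (AutomorphyDatum.gl 2 K hcpt).ofArch u θ))) := by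
  have hκc : Continuous κ := hκ.continuous
  have hκs : HasCompactSupport κ := hκ.hasCompactSupport
  set ZM : Matrix (Fin 2) (Fin 2) (mixedSpace K) := (Z : Matrix (Fin 2) (Fin 2) (mixedSpace K)) with hZM
  -- the three families
  have hA : IsDilRepresentable hcpt M 1 fun θ y => archUnipotentConv κ
      (derivWeight (AutomorphyDatum.gl 2 K hcpt).ofArch (toLie hcpt ((ZM 0 1) • (matE : Matrix (Fin 2) (Fin 2) (mixedSpace K))))
        (leftTranslateWeight (n := 2) (archDilationGL K y) (wordDerivWeight (AutomorphyDatum.gl 2 K hcpt).ofArch u θ))) := by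
    have h := (IsDilRepresentable.atom (hcpt := hcpt) (N := 1) ((hκ.fderiv_dir (ZM 0 1)).neg') u)
    refine h.congr fun θ hθ y => ?_
    have hθ' : IsTestFunctionGL 2 K (wordDerivWeight (AutomorphyDatum.gl 2 K hcpt).ofArch u θ) :=
      isTestFunctionGL_wordDerivWeight' hcpt hθ u
    show dilAtom (fun x => -fderiv ℝ κ x (ZM 0 1)) (wordDerivWeight (AutomorphyDatum.gl 2 K hcpt).ofArch u θ) y = _
    rw [dilAtom, archUnipotentConv_neg_kernel,
      ← archUnipotentConv_derivWeight_smul_matE hcpt (hθ'.leftTranslate _) hκ.contDiff hκs (ZM 0 1)]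
  have hB : IsDilRepresentable hcpt M 1 fun θ y => archUnipotentConv κ
      (derivWeight (AutomorphyDatum.gl 2 K hcpt).ofArch (toLie hcpt (diagDirGL2 (ZM 0 0) (ZM 1 1)))
        (leftTranslateWeight (n := 2) (archDilationGL K y) (wordDerivWeight (AutomorphyDatum.gl 2 K hcpt).ofArch u θ))) := by
    have h := (IsDilRepresentable.atom (hcpt := hcpt) (N := 1) hκ (toLie hcpt (diagDirGL2 (ZM 0 0) (ZM 1 1)) :: u))
    refine h.congr fun θ hθ y => ?_
    have hθ' : IsTestFunctionGL 2 K (wordDerivWeight (AutomorphyDatum.gl 2 K hcpt).ofArch u θ) :=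
      isTestFunctionGL_wordDerivWeight' hcpt hθ u
    show dilAtom κ (wordDerivWeight (AutomorphyDatum.gl 2 K hcpt).ofArch (toLie hcpt (diagDirGL2 (ZM 0 0) (ZM 1 1)) :: u) θ) y = _
    rw [dilAtom, wordDerivWeight_cons, derivWeight_leftTranslate_archDilation_diagDir hcpt hθ']
  have hC : IsDilRepresentable hcpt M 1 fun θ y => archUnipotentConv κ
      (derivWeight (AutomorphyDatum.gl 2 K hcpt).ofArch (toLie hcpt (lowerDirGL2 (ZM 1 0)))
        (leftTranslateWeight (n := 2) (archDilationGL K y) (wordDerivWeight (AutomorphyDatum.gl 2 K hcpt).ofArch u θ))) := by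
    have h : IsDilRepresentable hcpt M (0 + 1) fun θ y => ∑ b, (stdBasis K).repr ((y : mixedSpace K) * ZM 1 0) b •
        dilAtom κ (wordDerivWeight (AutomorphyDatum.gl 2 K hcpt).ofArch (toLie hcpt (lowerDirGL2 (stdBasis K b)) :: u) θ) y := by
      refine IsDilRepresentable.sum _ fun b _ => ?_
      exact (IsDilRepresentable.atom (hcpt := hcpt) (N := 0) hκ _).coeff_smul (isTorusCoeff_repr_mul b (ZM 1 0)) (N' := 1)
        fun w => by by_cases hw : w = indexPlace K b <;> simp [hw]
    rw [zero_add] at h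
    refine h.congr fun θ hθ y => ?_
    have hθ' : IsTestFunctionGL 2 K (wordDerivWeight (AutomorphyDatum.gl 2 K hcpt).ofArch u θ) :=
      isTestFunctionGL_wordDerivWeight' hcpt hθ u
    rw [derivWeight_leftTranslate_archDilation_lowerDir_expand hcpt hθ',
      archUnipotentConv_sum_weight hκc hκs _ fun b _ => ?_]
    · refine Finset.sum_congr rfl fun b _ => ?_
      rw [archUnipotentConv_smul_weight, dilAtom, wordDerivWeight_cons]
    · exact ((isTestFunctionGL_derivWeight hcpt hθ' _).leftTranslate _).continuous.const_smul _
  -- assemble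
  refine ((hA.add hB).add hC).congr fun θ hθ y => ?_
  have hθ' : IsTestFunctionGL 2 K (wordDerivWeight (AutomorphyDatum.gl 2 K hcpt).ofArch u θ) :=
    isTestFunctionGL_wordDerivWeight' hcpt hθ u
  rw [derivWeight_split_letters hcpt (hθ'.leftTranslate (archDilationGL K y)) Z,
    archUnipotentConv_add_weight hκc hκs, archUnipotentConv_add_weight hκc hκs]
  · exact (isTestFunctionGL_derivWeight hcpt (hθ'.leftTranslate _) _).continuous
  · exact (isTestFunctionGL_derivWeight hcpt (hθ'.leftTranslate _) _).continuous
  · exact (isTestFunctionGL_derivWeight hcpt (hθ'.leftTranslate _) _).continuous.add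
      (isTestFunctionGL_derivWeight hcpt (hθ'.leftTranslate _) _).continuous
  · exact (isTestFunctionGL_derivWeight hcpt (hθ'.leftTranslate _) _).continuous

/-- **One letter on an atom**: for a moment kernel `g` of order `≥ M + 2` and a word `u`,
`(θ, y) ↦ (g ⋆ L_{a(y)} θ_u)_X` is `(M, 1)`-representable. [cite: JacquetShalikaAJM1981, §4] -/
theorem isDilRepresentable_derivWeight_dilAtom {M : ℕ} {g : mixedSpace K → ℝ}
    (hg : IsMomentKernelGE K (M + 2) g) (u : List (AutomorphyDatum.gl 2 K hcpt).arch.lie)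
    (X : (AutomorphyDatum.gl 2 K hcpt).arch.lie) :
    IsDilRepresentable hcpt M 1 fun θ y => derivWeight (AutomorphyDatum.gl 2 K hcpt).ofArch X
      (dilAtom g (wordDerivWeight (AutomorphyDatum.gl 2 K hcpt).ofArch u θ) y) := by
  have hg0 : IsMomentKernelGE K M g := hg.mono (Nat.le_add_right M 2)
  have hg1 : ∀ b, IsMomentKernelGE K M fun x => (stdBasis K).repr x b * g x := fun b =>
    (hg.mono (Nat.le_succ _)).coord_mul b
  have hg2 : ∀ b b', IsMomentKernelGE K M fun x => (stdBasis K).repr x b * (stdBasis K).repr x b' * g x := fun b b' =>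
    hg.coord_mul_coord_mul b b'
  have h := ((isDilRepresentable_conv_derivWeight_leftTranslate hg0 u X).add
    (IsDilRepresentable.sum (Finset.univ : Finset (index K)) fun b _ =>
      isDilRepresentable_conv_derivWeight_leftTranslate (hg1 b) u
        (toLie hcpt ((stdBasis K b) • adTerm₁ (X : Matrix (Fin 2) (Fin 2) (mixedSpace K)))))).add
    (IsDilRepresentable.sum (Finset.univ : Finset (index K)) fun b _ =>
      IsDilRepresentable.sum (Finset.univ : Finset (index K)) fun b' _ =>
        isDilRepresentable_conv_derivWeight_leftTranslate (hg2 b b') u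
          (toLie hcpt ((stdBasis K b * stdBasis K b') • adTerm₂ (X : Matrix (Fin 2) (Fin 2) (mixedSpace K)))))
  refine h.congr fun θ hθ y => ?_
  have hθ' : IsTestFunctionGL 2 K (wordDerivWeight (AutomorphyDatum.gl 2 K hcpt).ofArch u θ) :=
    isTestFunctionGL_wordDerivWeight' hcpt hθ u
  rw [dilAtom, derivWeight_archUnipotentConv_expand hcpt (hθ'.leftTranslate (archDilationGL K y)) hg.contDiff hg.hasCompactSupport X]

end OneLetter

/-! ### One letter on a representable family; words -/

namespace IsDilRepresentable

variable {hcpt}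
variable {M N : ℕ}

set_option maxHeartbeats 1000000 in
/-- **One letter**: if `Φ` is `(M+2, N)`-representable then `(θ, y) ↦ (Φ θ y)_X` is
`(M, N+1)`-representable. [cite: JacquetShalikaAJM1981, §4] -/
theorem derivWeight {Φ : (GL (Fin 2) (AdeleRing (𝓞 K) K) → ℝ) → (mixedSpace K)ˣ → GL (Fin 2) (AdeleRing (𝓞 K) K) → ℝ}
    (hΦ : IsDilRepresentable hcpt (M + 2) N Φ) (X : (AutomorphyDatum.gl 2 K hcpt).arch.lie) :
    IsDilRepresentable hcpt M (N + 1) fun θ y => Literature.NumberTheory.Automorphic.derivWeight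
      (AutomorphyDatum.gl 2 K hcpt).ofArch X (Φ θ y) := by
  obtain ⟨ι', _, T, hT, hΦT⟩ := hΦ
  -- each term: coefficient times the derivative of an atom
  have hterm : ∀ i, IsDilRepresentable hcpt M (N + 1) fun θ y => (T i).coeff y •
      Literature.NumberTheory.Automorphic.derivWeight (AutomorphyDatum.gl 2 K hcpt).ofArch X
        (dilAtom (T i).kernel (wordDerivWeight (AutomorphyDatum.gl 2 K hcpt).ofArch (T i).word θ) y) := by
    intro i
    have h1 := isDilRepresentable_derivWeight_dilAtom (hcpt := hcpt) (hT i).2.2 (T i).word X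
    exact (h1.coeff_smul (hT i).1 (N' := N) (hT i).2.1).mono le_rfl (add_comm 1 N).le
  have hsum := IsDilRepresentable.sum (Finset.univ : Finset ι') fun i _ => hterm i
  refine hsum.congr fun θ hθ y => ?_
  have hdiff : ∀ i ∈ (Finset.univ : Finset ι'), ∀ g : (AdelicGroupData.gl 2 K).Adelic,
      DifferentiableAt ℝ (fun t : ℝ => (T i).eval hcpt θ y (((AutomorphyDatum.gl 2 K hcpt).ofArch
        ((AutomorphyDatum.gl 2 K hcpt).arch.expMem (t • X)))⁻¹ * g)) 0 := by
    intro i _ g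
    have hθ' : IsTestFunctionGL 2 K (wordDerivWeight (AutomorphyDatum.gl 2 K hcpt).ofArch (T i).word θ) :=
      isTestFunctionGL_wordDerivWeight' hcpt hθ (T i).word
    have ha := isTestFunctionGL_dilAtom (hT i).2.2.contDiff (hT i).2.2.hasCompactSupport hθ' y
    exact (differentiableAt_weight_expMem hcpt ha X g).const_mul ((T i).coeff y)
  rw [hΦT θ hθ y, derivWeight_finset_sum _ _ _ X hdiff]
  refine Finset.sum_congr rfl fun i _ => ?_
  rw [DilTerm.eval, derivWeight_smul_weight]

/-- **Words**: if `Φ` is `(M + 2|w|, N)`-representable then `(θ, y) ↦ wordDerivWeight w (Φ θ y)` is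
`(M, N + |w|)`-representable. [cite: JacquetShalikaAJM1981, §4] -/
theorem wordDerivWeight :
    ∀ (w : List (AutomorphyDatum.gl 2 K hcpt).arch.lie) {M N : ℕ}
      {Φ : (GL (Fin 2) (AdeleRing (𝓞 K) K) → ℝ) → (mixedSpace K)ˣ → GL (Fin 2) (AdeleRing (𝓞 K) K) → ℝ},
      IsDilRepresentable hcpt (M + 2 * w.length) N Φ →
        IsDilRepresentable hcpt M (N + w.length) fun θ y =>
          Literature.NumberTheory.Automorphic.wordDerivWeight (AutomorphyDatum.gl 2 K hcpt).ofArch w (Φ θ y)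
  | [], M, N, Φ, hΦ => hΦ.congr fun _ _ _ => rfl
  | X :: w, M, N, Φ, hΦ => by
    have hlen : M + 2 * (X :: w).length = (M + 2) + 2 * w.length := by simp [List.length_cons]; ring
    rw [hlen] at hΦ
    have ih := wordDerivWeight w hΦ
    exact (ih.derivWeight X).congr fun _ _ _ => rfl

end IsDilRepresentable

/-- **The word expansion of an atom**: for a moment kernel `g` of order `≥ M + 2|w|` and an
archimedean word `w`, the family `(θ, y) ↦ (g ⋆ L_{a(y)} θ)_w` is `(M, |w|)`-representable: there
are finitely many coefficients `c_j` with `|c_j(y)| ≤ C_j ∏_w |y_w|_w^{m_{j,w}}`, `m_{j,w} ≤ |w|`,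
moment kernels `g_j` of order `≥ M` and words `u_j`, all independent of `θ`, such that for every
test function `θ` and every `y ∈ K_∞ˣ`,
`(g ⋆ L_{a(y)} θ)_w = ∑_j c_j(y) · (g_j ⋆ L_{a(y)} θ_{u_j})`. [cite: JacquetShalikaAJM1981, §4] -/
theorem isDilRepresentable_wordDerivWeight_dilAtom (w : List (AutomorphyDatum.gl 2 K hcpt).arch.lie) {M : ℕ}
    {g : mixedSpace K → ℝ} (hg : IsMomentKernelGE K (M + 2 * w.length) g) :
    IsDilRepresentable hcpt M w.length fun θ y =>
      wordDerivWeight (AutomorphyDatum.gl 2 K hcpt).ofArch w (dilAtom g θ y) := by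
  have h0 : IsDilRepresentable hcpt (M + 2 * w.length) 0 fun θ y => dilAtom g θ y :=
    (IsDilRepresentable.atom (hcpt := hcpt) (N := 0) hg []).congr fun _ _ _ => rfl
  have h := IsDilRepresentable.wordDerivWeight w h0
  rwa [zero_add] at h

end Literature.NumberTheory.Automorphic
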